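import Summits.SmoothPoincare4.SmoothPoincare4.Theorems.CongruenceShadowsNormalFormStablyTrivialLuftDefs

/-!
# Stub `stub_gateAscent` of line `luft-twist-reduction` for crux `NormalFormStablyTrivial`
# (item stmt-SmoothPoincare4-14591, route `CongruenceShadows`) — gate data ascend along stabilisation

Proves the registered stub **`stub_gateAscent : nielsen_surfaceGroup_mulEquiv_lift → GateAscent`**
verbatim (`GateAscent`, `…LuftDefs.lean` §4): granted Nielsen's lifting theorem, if `K` is a gate
triple at level `m` (`InGate m K`: `K₀ = N₀`, `K₁ = N₁`, `π₁ = 1`, `K₂ = β N₂ = γ N₂` with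
`β ∈ Stab N₀`, `γ ∈ Stab N₁`, `N = s4Kernels.stabilizeIter m`) then its `n`-fold stabilisation,
transported to level `m + n`, is a gate triple at level `m + n`.

* §1 `inGate_stabilize` — the ONE-STEP ascent `InGate m K → InGate (m+1) K.stabilize`:
  `K₀ = N₀`, `K₁ = N₁` ascend slot-wise (`TrisectionKernels.stabilize_apply`, and
  `N (m+1) = (N m).stabilize` definitionally); `π₁ = 1` ascends by
  `stabilize_isGroupTrisection_holds` after upgrading the gate triple to a group trisection of the
  trivial group (`pairsStandard_of_inGate`, `isGroupTrisection_of_pairsStandard`); the gate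
  automorphisms ascend by `TrisectionKernels.iso_stabilize_map_of_lift` + Nielsen (the pattern of
  `pairsStandard_stabilize_of_nielsen`).
* §2 transport: `inGate_cast` (same level, any cast), `inGate_stabilize_cast` (one step through a
  cast, by `subst`), and the stub by induction on `n`.

References: Abrams–Gay–Kirby, Geom. Topol. 22 (2018), Def. 3; Nielsen, Acta Math. 50 (1927).
-/

-- the prescribed namespace `Summit.<P>.<Sub>.…` duplicates `SmoothPoincare4` (P = Sub)
set_option linter.dupNamespace false

noncomputable section

namespace Summit.SmoothPoincare4.SmoothPoincare4.Theorems.NormalFormStablyTrivial.Luft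

open Literature.Topology.FourManifolds Subgroup
open Summit.SmoothPoincare4.SmoothPoincare4.Theorems.NormalFormStablyTrivial.Negative
  (InGate PairsStandard pairsStandard_of_inGate isGroupTrisection_of_pairsStandard)

/-! ## §1 One-step ascent -/

/-- **One-step gate ascent** (modulo Nielsen): if `K` is a gate triple at level `m` then
`K.stabilize` is a gate triple at level `m + 1`. [folklore] -/
theorem inGate_stabilize (hN : nielsen_surfaceGroup_mulEquiv_lift) {m : ℕ}
    {K : TrisectionKernels (3 + 3 * m)} (hK : InGate m K) : InGate (m + 1) K.stabilize := by
  have hP : PairsStandard m K := pairsStandard_of_inGate hK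
  obtain ⟨h0, h1, hs, ⟨β, hb0, hb2⟩, ⟨γ, hc1, hc2⟩⟩ := hK
  -- `π₁ = 1` ascends: a gate triple is a group trisection of the trivial group, so is its
  -- stabilisation
  letI : Unique K.tripleQuotient := @uniqueOfSubsingleton _ hs 1
  have hGT : IsGroupTrisection (3 + 3 * m) (m + 1) (PUnit : Type) K :=
    isGroupTrisection_of_pairsStandard hP ⟨MulEquiv.ofUnique⟩
  obtain ⟨e⟩ := (stabilize_isGroupTrisection_holds _ _ _ _ hGT).triple
  -- the gate automorphisms ascend by Nielsen
  obtain ⟨β', hβ'⟩ :=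
    TrisectionKernels.iso_stabilize_map_of_lift (s4Kernels.stabilizeIter m) β (hN _ β)
  obtain ⟨γ', hγ'⟩ :=
    TrisectionKernels.iso_stabilize_map_of_lift (s4Kernels.stabilizeIter m) γ (hN _ γ)
  refine ⟨?_, ?_, e.toEquiv.subsingleton, ⟨β', ?_, ?_⟩, ⟨γ', ?_, ?_⟩⟩
  · show K.stabilize 0 = (s4Kernels.stabilizeIter m).stabilize 0
    simp only [TrisectionKernels.stabilize_apply, h0]
  · show K.stabilize 1 = (s4Kernels.stabilizeIter m).stabilize 1
    simp only [TrisectionKernels.stabilize_apply, h1]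
  · show ((s4Kernels.stabilizeIter m).stabilize 0).map β'.toMonoidHom =
      (s4Kernels.stabilizeIter m).stabilize 0
    rw [hβ' 0]
    simp only [TrisectionKernels.stabilize_apply, hb0]
  · show ((s4Kernels.stabilizeIter m).stabilize 2).map β'.toMonoidHom = K.stabilize 2
    rw [hβ' 2]
    simp only [TrisectionKernels.stabilize_apply, hb2]
  · show ((s4Kernels.stabilizeIter m).stabilize 1).map γ'.toMonoidHom =
      (s4Kernels.stabilizeIter m).stabilize 1
    rw [hγ' 1]
    simp only [TrisectionKernels.stabilize_apply, hc1]
  · show ((s4Kernels.stabilizeIter m).stabilize 2).map γ'.toMonoidHom = K.stabilize 2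
    rw [hγ' 2]
    simp only [TrisectionKernels.stabilize_apply, hc2]

/-! ## §2 Transport and the stub -/

/-- Gate data are invariant under transport between (equal) levels. [folklore] -/
theorem inGate_cast {m m' : ℕ} {K : TrisectionKernels (3 + 3 * m)} (h : 3 + 3 * m = 3 + 3 * m')
    (hK : InGate m K) : InGate m' (K.cast h) := by
  obtain rfl : m' = m := by omega
  exact hK

/-- One-step ascent through a transport: if the transport of `K` to level `m` is a gate triple,
so is the transport of `K.stabilize` to level `m'` (necessarily `m' = m + 1`). [folklore] -/
theorem inGate_stabilize_cast (hN : nielsen_surfaceGroup_mulEquiv_lift) {g m m' : ℕ}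
    (K : TrisectionKernels g) (e : g = 3 + 3 * m) (e' : g + 3 = 3 + 3 * m')
    (hK : InGate m (K.cast e)) : InGate m' (K.stabilize.cast e') := by
  subst e
  obtain rfl : m' = m + 1 := by omega
  exact inGate_stabilize hN hK

/-- **STUB `stub_gateAscent`** (registered signature, verbatim): granted Nielsen, gate data
ascend along stabilisation — `InGate m K → InGate (m + n) ((K.stabilizeIter n).cast _)`.
[folklore] -/
theorem stub_gateAscent : nielsen_surfaceGroup_mulEquiv_lift → GateAscent := by
  intro hN m K n hK
  induction n with
  | zero => exact inGate_cast (level_add m 0) hK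
  | succ n ih =>
    exact inGate_stabilize_cast hN (K.stabilizeIter n) (level_add m n) (level_add m (n + 1)) ih

end Summit.SmoothPoincare4.SmoothPoincare4.Theorems.NormalFormStablyTrivial.Luft

end
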